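import Literature.NumberTheory.EllipticCurves.PAdicBSD
import Literature.NumberTheory.EllipticCurves.PadicSigmaSq
import Literature.NumberTheory.EllipticCurves.BSDRootNumberSmallConductorProofs
import HarnessLib

/-!
# The `p`-adic BSD leading term at a GOOD ORDINARY prime in analytic rank one, WITH `#Ш_an`: the case IN PRINT
# at EVERY ordinary prime, `p = 2` included (Disegni 2020, Thm. 1 = Thm. 4 (first bullet))

Topic `Literature/NumberTheory/EllipticCurves` (prelude `PAdicBSD`, bsd.S24; companion of
`PAdicBSDMultiplicativeRankOne.lean`, which records the same theorem at a multiplicative prime for `p ≠ 2`, and of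
`PAdicGrossZagier.lean`, whose `perrinRiou_rankOne_leadingTerms` is Perrin-Riou's 1987 form at good ordinary `p ≥ 5`).
ONE NAMED FACT (nothing asserted; D-0014) and two small proved corollaries. Written on the vendoring ask of the cell
`bsd-f1-sign2` (seats bsd-line-gk2-p3 g6, HOME/INBOX.md 2026-08-28T03:07:39Z; -es g5, 03:35:51Z: «vendor
`Disegni2020.padicBSD_goodOrd_rankOne` for every ordinary `p` INCLUDING `2` in the `IsCanonicalSq` / K2 currency») after
the placement audit REF2-PLACEMENT-v17 §1 (A) (HOME/REF2-PLACEMENT-v17.md 2dba8ca5ecd8473e, 2026-08-28T04:56:54Z): «Disegni 2020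
Thm 1 = Thm 4(i) for good-ordinary / non-split-multiplicative `p` and `r_an ≤ 1` is IN PRINT AS STATED AT `p = 2`,
parity-free (`p ≥ 5` only in the split-multiplicative `r = 1` bullet); proof inputs at `2` checked one by one». HONEST
FRAMING: this records which instance of the cell's K2-G′v identity (`Summit.…F1Sign2.TwoAdicShaAnTransferRankOneAt`, the
rank-one `2`-adic leading-term identity with the ARCHIMEDEAN analytic sha) is a theorem of the refereed literature; with it,
K2-G′v at a good ordinary `2` = (this fact) ∧ (Schneider's non-degeneracy `Reg₂ ≠ 0`, OPEN). Nothing here is «finishing BSD».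

## The statement shape (tree vocabulary; normalisation table of `PAdicBSD`, dictionary of `PAdicGrossZagier`)

`W` a globally minimal model of `E/ℚ`, `p` a prime of GOOD ORDINARY reduction (`IsOrdinaryAt W p`: good reduction and
`p ∤ a_p`), unit root `α = unitRoot W p ∈ ℤ_p^×`, `f` the newform of `E` (`IsNewformOf W f`), `Ω⁺_f = ϖ · Ω_E`
(`plusPeriod f`, `W.realPeriodRat`, `ϖ ∈ ℚ`), `L = padicLFunction f α ∈ ℚ_p⟦T⟧` the Mazur–Swinnerton-Dyer / MTT `p`-adic
`L`-function of the `Ω⁺_f`-normalised modular symbols in `1 + T ↔ γ = cyclotomicGenerator p` (so `ϖ · L` is MTT's `L_p(E,T)`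
normalised by the Néron period, and `ϖ · [T¹]L · log_p γ = (d/ds) L_p(E, γ^s − 1)|_{s=0}` is the derivative at the trivial
character, independent of `γ`), `D` THE canonical cyclotomic `p`-adic height on `E(ℚ)` in the tree's sigma-SQUARED receptacle
(`WeierstrassCurve.PAdicHeightData.IsCanonicalSq D`: `⟨P,P⟩_D = log_p den x(P) − log_p Σ_p(z(P)) = 2 log_p(e(P)/σ_p(P))`, Stein–Wuthrich
2013 (4.1); `= IsCanonical D` whenever the Mazur–Tate pair exists, i.e. at every odd good ordinary `p` —
`isCanonicalSq_iff_isCanonical_of_exists`), `Reg_p = padicRegulator D` (Gram determinant on a basis of `E(ℚ)/tors`), and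
`#Ш_an = shaAn W = L'(E,1) · #E(ℚ)_tors² / (Ω_E · ∏_v c_v · Reg_NT(E))` (Miller 2011 §1). The rank-one identity is

  (GO)  `ϖ · [T¹]L · log_p(γ) · #E(ℚ)_tors² = (1 − α⁻¹)² · #Ш_an · Reg_p · ∏_v c_v`   in `ℚ_p`,

i.e. the leading-term clause of the tree's `PAdicBSDConjecture`-shape (two Euler-type factors at a good prime) at
`r = rank E(ℚ) = r_an = 1`, with `#Ш(E/ℚ)` replaced by `#Ш_an` — EXACTLY the displayed hypothesis `hEx` of the cell's
`Summit.….Theorems.MinimalTwinBSDTwo.twoAdicShaAnTransferRankOneAt_of_exact` (p600245) at `p = 2`, for general `p`.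

## What is in print (held text `paper:arxiv-1609.02528` = D. Disegni, Kyoto J. Math. 60 (2020) 473–510, bib `Disegni2020`;
## re-read for this file 2026-08-28; locators = materialised pages/lines)

* §1.1 (p0003 L12): «Fix a rational prime `p` and assume throughout this paper that `A/K` is an elliptic curve with ordinary
  (good or multiplicative) reduction at all primes `𝔭 ∣ p` of `K`.» — no parity hypothesis on `p` anywhere in §1–§3.2.1
  (REF2 v17 §1: «`p ≥ 5`» occurs only in the split-multiplicative `r = 1` bullet; [dd] = Disegni, Compos. Math. 153 (2017),
  «We fix from now on a rational prime `p`», arXiv:1510.02114 p0005 L6, its `p ≥ 5` only in the anticyclotomic Thm. 4 and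
  `p ∤ 2D_F h⁻` only in the CM Thm. 5; Errata 2019 / Corrigendum 2024 add no parity condition).
* Hypothesis `(L_p)` (p0003 L25–L60): `L_p^{(Γ)}(A) ∈ 𝓞_L⟦Γ⟧ ⊗ L` interpolating `∏_𝔭 e_𝔭(χ_𝔭) · L(A,χ,1)/(|D_K|^{−1/2} Ω_A)`,
  `Ω_A` «the Néron period appearing in the Birch and Swinnerton-Dyer conjecture», `e_𝔭(χ) = (1 − α_𝔭χ(𝔭))(1 − α'_𝔭χ(𝔭)⁻¹)`
  (unramified), `α_𝔭^{−𝔣}τ(χ_𝔭)` (ramified), `α' = α⁻¹` at good reduction; «the interpolation property determines `L_p^{(Γ)}(A)`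
  uniquely if it exists»; for `K = ℚ` it exists (Prop. 1, p0009 L60–L69: «a theorem of Amice–Vélu and Vishik (see [mtt]) for
  `E` … the proof of the functional equation in [PRL] applies to the case `p = 2`»).
* Hypothesis `(BSD_∞)` (p0005 L1–L12): (1) `r_an(A) = rk A(K)`; (2) `|Ш(A)|_an := L^{(r)}(A,1)/(r! |D_K|^{−1/2} R_NT(A) Ω_A
  ∏_v c_v(A)) ∈ ℚ^×`; regulators are DISCRIMINANTS `R(M,h) := [M : Σ ℤxᵢ]^{−2} · det h(xᵢ,xⱼ)` (Def. 1, p0008; §1.1.3 p0004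
  L55: «it also accounts for `|A(K)_tors|²`»), so for `K = ℚ`: `|Ш(A)|_an = L^{(r)}(E,1) · #E(ℚ)_tors² /(r! Ω_E Reg_NT ∏c_v)`
  = the tree's `shaAn W`.
* Conjecture `(BSD_p)` (p0005 L16–L36): `A` ordinary at all `𝔭 ∣ p`, `(L_p)` and `(BSD_∞)`-(1),(2), `ord_{s=1} L(A,s) = r`,
  `r̃ = r + |S_p^exc|`; then `L_p^{(Γ)}(A)` vanishes at `𝟙` to order `≥ r̃`, `A†(K)_{ℚ_p} ≅ H̃¹_f` of dimension `r̃`, and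
  `d^{r̃} L_p^{(Γ)}(A,𝟙) = ∏_{𝔭∣p} ẽ_𝔭(𝟙) · R̃_ℓ(A) · |Ш(A)|_an · ∏_v c_v(A)` in `Sym^{r̃}Γ ⊗ L`, `R̃_ℓ` the discriminant of the
  extended height `h̃_ℓ` (§2.1, p0008 L8–L12: «entirely taken from [mtt] and [nekheights]»; `h̃ = h = h^can` and
  `h^norm = h^can` when `S_p^exc = ∅`, p0008 L40–L45).
* **Theorem 1** (§1.2, p0005 L51–L58): «Let `E/ℚ` be an elliptic curve of conductor `N` with ordinary reduction at the prime
  `p`. Suppose that `r_an := ord_{s=1} L(E,s) ≤ 1` and that (∗) if `r_an = 1` and `S_p^exc(E) ≠ ∅`, then `p ≥ 5` and there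
  exists another prime `m ≠ p` of multiplicative reduction for `E`. Then Hypotheses `(L_p)` and `(BSD_∞)`-(1)-(2) are
  satisfied, and Conjecture `(BSD_p)` holds.» = **Theorem 4, first bullet** (§3.2, p0011 L64–L68): «If the reduction of `E` at
  `p` is not split multiplicative or `r = 0`, then Conjecture `(BSD_p)` holds.» Proof for `r = 1`, not split multiplicative
  (§3.2.1, p0012 L1–L7): Lemma (invar) (isogeny / base-change invariance), `K` imaginary quadratic with all `ℓ ∣ N` split and
  `L(E^{(K)},1) ≠ 0` ([murty2]), Cor. (index-heeg) and the `p`-adic Gross–Zagier formula Thm. 3 (p0009 L71–L84: «suppose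
  moreover that `p` splits in `K`, and that `E` has ordinary (good or multiplicative) reduction at `p`» — «a special case of the
  analogous result to [cst], which can be obtained by applying word for word the arguments of op. cit. to [dd] instead of
  [yzz]. When `E` has good reduction and all `v ∣ N` split in `K`, this formula was proved by Perrin-Riou [PR]»); footnote:
  «This argument was of course already made by Perrin-Riou [PR] when `E` has good reduction.»
* **Proposition 2** (§3.1, p0011 L16–L25): under `(L_p)` and `(BSD_∞)`-(1),(2), `(BSD_p)` ⟺
  `d^{r̃} L_p(A^{(Γ_ℚ)},𝟙) = ∏_{𝔭 ∉ exc} e_𝔭(𝟙) ∏_{𝔭 ∈ exc} 𝓛_𝔭(A) · R^norm_{ℓ_Γ}(A) · L^*_alg(A,1)`,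
  `L^*_alg(A,1) := L^{(r)}(A,1)/(r! |D_K|^{−1/2} Ω_A R_NT(A))`; «The proof, by elementary linear algebra, is already given in
  [mtt] in slightly different language» — i.e. `(BSD_p)` for `(E/ℚ, Γ_ℚ)` IS Mazur–Tate–Teitelbaum's conjecture `BSD(p)`.

## Transcription choices (faithfulness notes)

* HOMOGENEITY. For `K = ℚ`, `r̃ = r = 1`, both sides of `(BSD_p)` are of degree `1` in `Γ_ℚ ⊗ L`, so ANY identification
  `Γ_ℚ ⊗ ℚ_p ≅ ℚ_p` (here `ℓ = log_p ∘ χ_cyc`) gives the same `ℚ_p`-identity: `d L_p(E,𝟙) ↦ (d/ds)L_p(E,γ^s − 1)|_{s=0} =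
  ϖ · [T¹]L · log_p γ`, `R^norm(E) ↦ ⟨P,P⟩_D/[E(ℚ) : ℤP]² = Reg_p(D)/#E(ℚ)_tors²` (`D` the canonical CYCLOTOMIC height,
  `P` a generator mod torsion), exactly as in `PAdicBSDMultiplicativeRankOne.lean`.
* THE `p`-ADIC MULTIPLIER. By Prop. 2, `(BSD_p)` for `(E/ℚ, Γ_ℚ)` is MTT's `BSD(p)`, whose interpolating function is the
  tree's `ϖ · padicLFunction f α` (bounded measure, unique by its values at the wildly ramified characters, MTT §I.14;
  `existsUnique_…` in `PAdicLFunction`) and whose good-ordinary rank-one leading term in the tree's normalisations is (GO)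
  with the factor `(1 − α⁻¹)²` (MTT §II.10 / Greenberg LNM 1716 §4; Stein–Wuthrich 2013 §9, display before Thm. 9.1 —
  quoted in `perrinRiou_rankOne_leadingTerms` — : «`(1/Reg(E/ℚ))·L'(E,1)/Ω_E = (1/Reg_p(E/ℚ))·(L_p'(E,0)/(1 − 1/α)²)·log(κ(γ))`»,
  multiply by `Reg_p · #tors²/#tors²` and insert Miller's `#Ш_an`). The printed `e_𝔭(𝟙)` belongs to Disegni's own
  normalisation of `L_p^{(Γ)}`; the vendored identity is the MTT-normalised equivalent that Prop. 2 asserts, never stronger.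
* THE HEIGHT RECEPTACLE (the one flag of this file; REF2 v17 §1 «ONE LINK NOT VERIFIED IN PRINT at 2 (non-CM)»). Print:
  `R^norm` is the discriminant of Schneider's norm-adapted height `=` Nekovář's / Mazur–Tate's canonical height `h^can` at a
  good ordinary prime (p0008). Tree: `IsCanonicalSq D` says the quadratic form of `D` on admissible points is the Mazur–Tate
  `σ²`-FORMULA. That the `σ`-formula computes the canonical Mazur–Tate / Schneider height is Mazur–Tate 1991 (the `p`-adic
  sigma function; through Mazur–Stein–Tate 2006 §1 eq. (1.1), Thm. 1.3 and Stein–Wuthrich 2013 §4.2 + §6.1 «these heights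
  agree with the height in Section 4.2») — printed and held for ODD `p`; at `p = 2` the squared sigma function exists and is
  unique (Silverman 2005, Remark 2 after Thm. 11, arXiv:math/0404412 p0011 L22: «Theorem 11 remains true for `p = 2` provided
  that everything is squared … a unique power series `σ² ∈ z² + z³R⟦z⟧`»; tree `mazurTate_sigmaSq_existsUnique_two`,
  `existsUnique_isCanonicalSq_two`), and the identification of the `σ²`-formula with the canonical height at `2` rests on
  Mazur–Tate 1991 itself (bib `MazurTate1991`, Duke 62; NOT held — cite-only, acq-00916 / acq-01927), restated in the held
  texts for odd `p` only (Silverman 2005 Thm. 11 «`p ≥ 3`»; MST 2006 «odd prime»; BMS 2016 «`p > 2`»). This is the STANDING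
  CONVENTION of the receptacle (`PadicSigmaSq.lean` docblock: «that identification … is carried by each consumer fact's
  citation, exactly as for `IsCanonical`»); it is recorded here, not hidden: at `p = 2` the vendored statement is Disegni's
  theorem COMPOSED WITH that identification. Consumers who need the `p = 2` instance free of it should carry
  `mazurTate_sigmaSq_existsUnique_two` and the MT91 identification as their own displayed inputs.
* GENERALITY FLAGS (weaker than printed, never stronger). (a) Only `r_an = 1` is vendored (at `r_an = 0` `(BSD_p)` is the
  interpolation property + `(BSD_∞)`; the cell does not need it here). (b) Of `(BSD_p)` only `|Ш|_an ∈ ℚ` (printed: `∈ ℚ^×`)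
  and the leading-term identity are vendored — not «order of vanishing `≥ 1`» (automatic: `L_p(𝟙) = (1 − α⁻¹)²L(E,1)/Ω⁺ = 0`)
  nor «`dim H̃¹_f = 1`» (⟸ finiteness of `Ш[p^∞]`, Kolyvagin). (c) The EXACT order of vanishing (`= 1`) is NOT in print: given
  (GO) it is `Reg_p ≠ 0`, Schneider's non-degeneracy (barrier `Barriers/BirchSwinnertonDyer/PAdicHeightNondegeneracy`; the
  cell's K2-S₂ `TwoAdicRegulatorNonvanishingRankOneOrd` at `p = 2`). (d) Good SUPERSINGULAR `p` is outside the paper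
  («ordinary» throughout). (e) At odd `p ≥ 5` the content overlaps `perrinRiou_rankOne_leadingTerms` (PR 1987 Thm. 1.3 /
  Cor. 1.8, «same rational `c`» form); new for the tree: `p ∈ {2, 3}` and the `#Ш_an`-explicit shape at every ordinary `p`.
* NUMERICAL CORROBORATION of the dictionary (evidence, not input): REF1-AUDIT-v1 §55 of cell bsd-f1-sign2 (kit j296926,
  Sage 10.9 + PARI 2.17): tree shape lhs/rhs `= 1 + O(p³)` on 37a1@5, 37a1@7, 43a1@5, 58a1@5; cell bsd-f1-sign2 -es g5 DES14
  (kit tag bsd-frontier-data, j296103/j297382/j296468/j297376/j297686; engine des14.gp = PARI `ellpadicheight` at `2` + a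
  canonical-subgroup `2`-isogeny tower for the unit-root slope): AT `p = 2`, `S₂ := L₂^*/(f − s₂g) = #Ш_an` to working
  precision on **479/479** good-ordinary rank-one curves (0 disagreements, Σ 2 420 bits; incl. 4305m5/4641a3/6195e3 with
  `Ш_an = 4`); `PAdicBSDMultiplicativeRankOne.lean`: (NS) multiplier exactly `2` on 507/507, good-ordinary calibration
  `(1 − α⁻¹)²` on 16/16.

## What is here

* `Disegni2020.padicBSD_goodOrd_rankOne` — NAMED FACT: (GO) with `#Ш_an ∈ ℚ`, at EVERY good ordinary prime `p` (no parity
  hypothesis), analytic rank one, over the `IsCanonicalSq` receptacle.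
* proved: `padicBSD_goodOrd_rankOne.shaAn_rational` (projection), `padicBSD_goodOrd_rankOne.norm_identity` (the identity of
  `p`-adic norms — the second conjunct of the cell's per-curve K2-G′v, so that at `p = 2`
  `TwoAdicShaAnTransferRankOneAt W ⟸ (this fact) ∧ (∀ canonical D, Reg₂ D ≠ 0)` is immediate for consumers).

NOT here: the anticyclotomic / imaginary-quadratic Theorem 2, the split-multiplicative bullet (see
`PAdicBSDMultiplicativeRankOne.lean`), totally real fields (Remark after §3.2.1: up to a period commensurability conjecture).
-/

set_option autoImplicit false

noncomputable section

open scoped Classical MatrixGroups ModularForm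

open CongruenceSubgroup WeierstrassCurve WeierstrassCurve.PAdicHeightData
  Literature.NumberTheory.EllipticCurves.ModularForms

namespace Literature.NumberTheory.EllipticCurves

namespace Disegni2020

/-- **Disegni 2020, Thm. 1 = Thm. 4 (first bullet), at a GOOD ORDINARY prime in analytic rank one — the `p`-adic BSD
leading-term identity WITH `#Ш_an`, every ordinary `p`, `p = 2` included** (D. Disegni, Kyoto J. Math. 60 (2020), Thm. 1
(§1.2) and Thm. 4 first bullet (§3.2): «Let `E/ℚ` be an elliptic curve with ordinary reduction at the prime `p`. Suppose
that `r := ord_{s=1} L(E,s) ≤ 1`. Then: if the reduction of `E` at `p` is not split multiplicative or `r = 0`, then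
[Hypotheses `(L_p)`, `(BSD_∞)`-(1)-(2) are satisfied and the statement] `(BSD_p)` holds» (his `(BSD_p)` is a prediction in general and a THEOREM in this case — this declaration records the proved case only); by his Prop. 2 (§3.1) `(BSD_p)` for
`(E/ℚ, Γ_ℚ)` is Mazur–Tate–Teitelbaum's `BSD(p)`). Transcription (module docstring): for a globally minimal `W/ℚ`, a prime
`p` with `IsOrdinaryAt W p` (good ordinary) and `W.analyticRank = 1`, the analytic order of sha `shaAn W` is a rational
number `q` (`(BSD_∞)`-(2), Gross–Zagier) and, for THE canonical cyclotomic `p`-adic height datum `D` (`IsCanonicalSq`; at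
`p = 2` this receptacle carries the Mazur–Tate 1991 identification «`σ²`-formula = canonical height», cite-only — see
«THE HEIGHT RECEPTACLE» above), every newform `f` of `W` and every period ratio `ϖ` (`ϖ · Ω_E = Ω⁺_f`):
`ϖ · [T¹]L_p(f,α) · log_p(γ) · #E(ℚ)_tors² = (1 − α⁻¹)² · q · Reg_p(D) · ∏_v c_v` in `ℚ_p`, `α = unitRoot W p`,
`γ = cyclotomicGenerator p`. Weaker than printed (rank one only; leading term and rationality only); nothing asserted
(named fact, D-0014); users take `(h : padicBSD_goodOrd_rankOne)`.
[cite: Disegni2020, Thm. 1 (§1.2) = Thm. 4 first bullet (§3.2), proof §3.2.1, Prop. 2 (§3.1), the statement (BSD_p) and Hypothesis (BSD_∞) (§1.1.4), Def. 1 (§2.1) (arXiv:1609.02528 pp. 3–5, 8, 11–12)]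
[cite: Disegni2017, Thm. B («We fix from now on a rational prime p»)]
[cite: MazurTateTeitelbaum1986Invent, §II.10 (BSD(p), leading term) and §I.14 (uniqueness)]
[cite: SteinWuthrich2013, §4 eq. (4.1) (the height), §9 display before Thm. 9.1 (normalisations)]
[cite: MazurTate1991, the σ-function computes the canonical height; σ² at p = 2 (cite-only, via Silverman 2005 Rem. 2)]
[cite: Miller2011LMS, §1 (#Ш_an)] -/
def padicBSD_goodOrd_rankOne : Prop :=
  ∀ (W : WeierstrassCurve ℚ) [W.IsElliptic] [W.IsGloballyMinimal] (p : ℕ) [Fact p.Prime],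
    IsOrdinaryAt W p → W.analyticRank = 1 →
    ∃ q : ℚ, shaAn W = (q : ℂ) ∧
      ∀ D : PAdicHeightData W p, D.IsCanonicalSq →
      ∀ ⦃N : ℕ⦄ [NeZero N] (f : CuspForm (Gamma0 N) 2), IsNewformOf W f →
      ∀ ϖ : ℚ, (ϖ : ℝ) * W.realPeriodRat = plusPeriod f →
        (ϖ : ℚ_[p]) * PowerSeries.coeff 1 (padicLFunction f (unitRoot W p : ℚ_[p])) *
            padicLog p (cyclotomicGenerator p) * (W.torsionOrder : ℚ_[p]) ^ 2 =
          (1 - (unitRoot W p : ℚ_[p])⁻¹) ^ 2 * ((q : ℚ_[p]) * padicRegulator D * W.tamagawaProduct)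

/-- Corollary (proved): under the hypotheses of `padicBSD_goodOrd_rankOne`, `#Ш_an ∈ ℚ` (Disegni's Hypothesis
`(BSD_∞)`-(2) in analytic rank one, a consequence of Gross–Zagier; the projection of the fact).
[cite: Disegni2020, Thm. 1 («Hypotheses (L_p) and (BSD_∞)-(1)-(2) are satisfied»)] -/
theorem padicBSD_goodOrd_rankOne.shaAn_rational (h : padicBSD_goodOrd_rankOne)
    (W : WeierstrassCurve ℚ) [W.IsElliptic] [W.IsGloballyMinimal] (p : ℕ) [Fact p.Prime]
    (hord : IsOrdinaryAt W p) (hr : W.analyticRank = 1) :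
    ∃ q : ℚ, shaAn W = (q : ℂ) :=
  let ⟨q, hq, _⟩ := h W p hord hr
  ⟨q, hq⟩

/-- Corollary (proved): the identity of `p`-adic NORMS of the two sides of (GO) — the shape of the second conjunct of the
cell bsd-f1-sign2's per-curve K2-G′v `TwoAdicShaAnTransferRankOneAt` (norms of equal things are equal), at every good
ordinary `p`; so at `p = 2` K2-G′v-At(W) follows from this fact and `∀ canonical D, padicRegulator D ≠ 0` alone.
[cite: Disegni2020, Thm. 1 = Thm. 4 first bullet] -/
theorem padicBSD_goodOrd_rankOne.norm_identity (h : padicBSD_goodOrd_rankOne)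
    (W : WeierstrassCurve ℚ) [W.IsElliptic] [W.IsGloballyMinimal] (p : ℕ) [Fact p.Prime]
    (hord : IsOrdinaryAt W p) (hr : W.analyticRank = 1) :
    ∃ q : ℚ, shaAn W = (q : ℂ) ∧
      ∀ D : PAdicHeightData W p, D.IsCanonicalSq →
      ∀ ⦃N : ℕ⦄ [NeZero N] (f : CuspForm (Gamma0 N) 2), IsNewformOf W f →
      ∀ ϖ : ℚ, (ϖ : ℝ) * W.realPeriodRat = plusPeriod f →
        ‖(ϖ : ℚ_[p]) * PowerSeries.coeff 1 (padicLFunction f (unitRoot W p : ℚ_[p])) *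
            padicLog p (cyclotomicGenerator p) * (W.torsionOrder : ℚ_[p]) ^ 2‖ =
          ‖(1 - (unitRoot W p : ℚ_[p])⁻¹) ^ 2 * ((q : ℚ_[p]) * padicRegulator D * W.tamagawaProduct)‖ := by
  obtain ⟨q, hq, hid⟩ := h W p hord hr
  exact ⟨q, hq, fun D hD N _ f hf ϖ hϖ ↦ congrArg _ (hid D hD f hf ϖ hϖ)⟩

end Disegni2020

end Literature.NumberTheory.EllipticCurves

end
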